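import Literature.AlgebraicGeometry.Morphisms.FibreChartRing
import Literature.AlgebraicGeometry.GroupSchemes.UnitComponentBaseChange
import Literature.AlgebraicGeometry.GroupSchemes.BarsottiTateGroupUnitComponentTower
import Mathlib.RingTheory.TensorProduct.Quotient
import Mathlib.RingTheory.Artinian.Module
import Mathlib.AlgebraicGeometry.AffineScheme
import HarnessLib

/-!
# The special-fibre stalk of the unit component: `Γ(G⁰) ⧸ 𝔪·Γ(G⁰) ≅ 𝒪_{G ×_A k, e}` ([Tate1967] §2.2; [Tate1997] (3.7))

Topic `Literature/AlgebraicGeometry/GroupSchemes`, namespace `Literature.AlgebraicGeometry.GroupSchemes` (engine in `….SpecialFibreStalk`).  THEOREMS ONLY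
(the ring isomorphisms are delivered as `∃ e, <its two defining formulas>` statements; no definition, no named fact, no instance, no notation, no `sorry`).
Cell `hodgecm-mathlib`, P6b «σ2» S1′-β split (σ) (desk F0P6b-plan (g14) 2026-09-03; σ-INTERFACE token of «L2» LA2-p01 (g7), consumed BY NAME by its
`UnitComponentTowerSpecialFibre` (τ)+(asm)); prover «L2» LA2-p04 (g8).  Generic, count-neutral capital on `--supports stmt-HodgeConjecture-24832`; HC_CM is
proved only modulo the printed citations until rung 0 closes; nothing here is about HC.

THE PRINT.  [Tate1967] §2.2 (proof of Prop. 1) and [Tate1997FiniteFlatGroupSchemes] (3.7): for a finite flat group scheme `G` over a henselian (e.g. Artinian,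
complete) local ring `A` with residue field `k`, the unit component `G⁰ = Spec A⁰` is open and closed in `G`, `A⁰` is a LOCAL `A`-algebra, and the connected
component of the special fibre `G ×_A k` at the origin is `G⁰ ×_A k = Spec (A⁰ ⊗_A k) = Spec (A⁰ ⧸ 𝔪A⁰)`, a local Artinian `k`-algebra — so the local ring of
`G ×_A k` at its unit point IS `A⁰ ⧸ 𝔪 A⁰`.  [GortzWedhorn2020] Prop. 4.20 (`Spec B ×_{Spec R} Spec T = Spec (B ⊗_R T)`) is the chart computation.

WHAT IS HERE.
* §1 `SpecialFibreStalk.exists_quotChartEquiv` — for ANY cartesian square `P →(π) X` over `Spec k → Spec A` (`A` local) and an affine open `W ⊆ X`: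
  `Γ(X, W) ⧸ 𝔪·Γ(X, W) ≃+* Γ(P, π⁻¹W)` (Mathlib `Algebra.TensorProduct.quotIdealMapEquivTensorQuot` + ★ `Morphisms.fibreChartIso`), with `[s] ↦ π^♯ s` and
  `[f^♯ a] ↦ t^♯ ā`;
* §2 `SpecialFibreStalk.bijective_germ_of_isLocalRing` — the germ map `Γ(P, U) → 𝒪_{P, w}` of an affine open whose ring of functions is LOCAL with every prime
  maximal is bijective at every `w ∈ U` (Mathlib `IsAffineOpen.isLocalization_stalk` + `IsLocalization.atUnits`);
* §3 `SpecialFibreStalk.exists_quotChartStalkEquiv` = §1 ≫ §2 with its two formulas; §4 `Γ(P, π⁻¹W)` is Artinian (finite over the field `k`) and local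
  (a quotient of a local chart ring);
* §5 for a homomorphic OPEN immersion `j : G₀ ↪ G` over `Spec A` with `G₀` affine, finite, connected: `SpecialFibreStalk.exists_sectionsEquivChartRing :
  Γ(G₀, ⊤) ≃+* ChartRing G.hom (j(G₀))` (Mathlib `Scheme.Hom.appIso`) carrying the structure map `Γ(G₀ → Spec A)^♯` to `algebraMap`; the chart ring is module-finite and LOCAL (★ `UnitComponent.finite_structureRingHom`, ★
  `UnitComponent.isLocalRing_of_connectedSpace`); a point over the unit point of `G` lies over `j(G₀)`;
* §6 **`exists_specialFibre_stalk_tower`** (the σ-INTERFACE, token-exact): over an ARTINIAN local `A`, for a tower of such `j n : G₀ n ↪ G n` with sub-tower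
  maps `incl₀` over homomorphic transitions `tr`, and ANY cartesian presentations `P n → G n` of the special fibres with maps `u` over `tr` and points `w n`
  over the unit points: ring isomorphisms `σ n : Γ(G₀ n) ⧸ 𝔪·Γ(G₀ n) ≃+* 𝒪_{P n, w n}`, NATURAL in `n` (against `incl₀^♯` and the stalk maps of `u`) and
  compatible with the structure maps.  (Token-exact except that the two IDLE binders of the token — `htr : IsMonHom (tr h)` and `hut : u h ≫ t m = t n` — are
  dropped: the proof never uses them.)

## References
* [Tate1967] J. Tate, *p-divisible groups*, Proc. Conf. Local Fields (Driebergen 1966), Springer 1967, §2.2 (proof of Prop. 1), (2.4).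
* [Tate1997FiniteFlatGroupSchemes] J. Tate, *Finite flat group schemes*, in: Modular Forms and Fermat's Last Theorem (1997), (3.7).
* [GortzWedhorn2020] U. Görtz, T. Wedhorn, *Algebraic Geometry I*, 2nd ed. (2020), Prop. 4.20, Thm. 4.18, §(3.2).
* [StacksProject] The Stacks Project, Tags 01I1 (affine schemes and localisation), 04GG (henselian local rings), 00J8 (Artinian rings).
-/

noncomputable section

set_option backward.isDefEq.respectTransparency false

universe u

open CategoryTheory CategoryTheory.Limits AlgebraicGeometry TopologicalSpace Opposite TensorProduct IsLocalRing

namespace Literature.AlgebraicGeometry.GroupSchemes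

open Literature.AlgebraicGeometry.Morphisms Literature.AlgebraicGeometry.Morphisms.ChartRing

namespace SpecialFibreStalk

variable {A : Type u} [CommRing A] [IsLocalRing A] {X : Scheme.{u}} (f : X ⟶ Spec (.of A)) {W : X.Opens} (hW : IsAffineOpen W)
  {P : Scheme.{u}} (π : P ⟶ X) (t : P ⟶ Spec (.of (ResidueField A)))
  (hP : IsPullback π t f (Spec.map (CommRingCat.ofHom (algebraMap A (ResidueField A)))))

/-! ## §1 ENGINE: `ChartRing f W ⧸ 𝔪 · ChartRing f W ≃+* Γ(P, π⁻¹ W)` for the special fibre `P = X ×_A k` -/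

include hW t hP in
/-- **`Γ(X, W) ⧸ 𝔪·Γ(X, W) ≅ Γ(P, π⁻¹W)`**: the quotient of the chart ring by the extension of the maximal ideal is the base change to the residue
field (Mathlib `Algebra.TensorProduct.quotIdealMapEquivTensorQuot`), which is the ring of functions of the special-fibre chart (★ `Morphisms.fibreChartIso`);
under the isomorphism `[s] ↦ π^♯ s` and `[f^♯ a] ↦ t^♯ ā` (`fibreConst`). [cite: GortzWedhorn2020, Prop. 4.20 and Thm. 4.18] [cite: StacksProject, Tag 01JO] -/
theorem exists_quotChartEquiv :
    ∃ e : (ChartRing f W ⧸ (maximalIdeal A).map (algebraMap A (ChartRing f W))) ≃+* Γ(P, π ⁻¹ᵁ W),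
      (∀ s : ChartRing f W, e (Ideal.Quotient.mk _ s) = π.app W (val s)) ∧
      (∀ a : A, e (Ideal.Quotient.mk _ (algebraMap A (ChartRing f W) a)) = fibreConst π t W (residue A a)) := by
  refine ⟨((Algebra.TensorProduct.quotIdealMapEquivTensorQuot (ChartRing f W) (maximalIdeal A)).toRingEquiv.trans
    (Algebra.TensorProduct.comm A (ChartRing f W) (ResidueField A)).toRingEquiv).trans (fibreChartIso f π t hP hW), fun s => ?_, fun a => ?_⟩
  · change fibreChartIso f π t hP hW (Algebra.TensorProduct.comm A (ChartRing f W) (ResidueField A)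
      (Algebra.TensorProduct.quotIdealMapEquivTensorQuot (ChartRing f W) (maximalIdeal A) (Ideal.Quotient.mk _ s))) = _
    rw [Algebra.TensorProduct.quotIdealMapEquivTensorQuot_mk, Algebra.TensorProduct.comm_tmul, fibreChartIso_one_tmul]
  · change fibreChartIso f π t hP hW (Algebra.TensorProduct.comm A (ChartRing f W) (ResidueField A)
      (Algebra.TensorProduct.quotIdealMapEquivTensorQuot (ChartRing f W) (maximalIdeal A) (Ideal.Quotient.mk _ _))) = _
    rw [Algebra.TensorProduct.quotIdealMapEquivTensorQuot_mk, Algebra.TensorProduct.comm_tmul,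
      Algebra.algebraMap_eq_smul_one, TensorProduct.tmul_smul, TensorProduct.smul_tmul', ← Algebra.algebraMap_eq_smul_one,
      ResidueField.algebraMap_eq, fibreChartIso_tmul_one]

/-! ## §2 ENGINE: the germ map of a LOCAL zero-dimensional affine open is bijective onto the stalk -/

/-- For an affine open `U ⊆ P` whose ring of functions is LOCAL with every prime ideal maximal (e.g. finite over a field), the germ map at ANY
point `w ∈ U` is BIJECTIVE `Γ(P, U) → 𝒪_{P, w}`: the stalk is the localisation of `Γ(P, U)` at the prime of `w` (Mathlib
`IsAffineOpen.isLocalization_stalk`), that prime is the maximal ideal, and its complement consists of units (Mathlib `IsLocalization.atUnits`).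
[cite: StacksProject, Tag 01I1] -/
theorem bijective_germ_of_isLocalRing {P : Scheme.{u}} {U : P.Opens} (hU : IsAffineOpen U) [IsLocalRing Γ(P, U)]
    (h0 : ∀ p : Ideal Γ(P, U), p.IsPrime → p.IsMaximal) (w : P) (hw : w ∈ U) : Function.Bijective (P.presheaf.germ U w hw) := by
  letI := TopCat.Presheaf.algebra_section_stalk P.presheaf (⟨w, hw⟩ : U)
  haveI := hU.isLocalization_stalk ⟨w, hw⟩
  have H : (hU.primeIdealOf ⟨w, hw⟩).asIdeal.primeCompl ≤ IsUnit.submonoid Γ(P, U) := by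
    intro x hx
    have hp : (hU.primeIdealOf ⟨w, hw⟩).asIdeal = maximalIdeal Γ(P, U) :=
      IsLocalRing.eq_maximalIdeal (h0 _ (hU.primeIdealOf ⟨w, hw⟩).isPrime)
    have hx' : x ∉ maximalIdeal Γ(P, U) := hp ▸ hx
    rw [IsLocalRing.mem_maximalIdeal, mem_nonunits_iff, not_not] at hx'
    exact hx'
  exact (IsLocalization.atUnits Γ(P, U) (hU.primeIdealOf ⟨w, hw⟩).asIdeal.primeCompl (S := P.presheaf.stalk w) H).bijective

/-! ## §3 ENGINE, assembled: `ChartRing f W ⧸ 𝔪 · ChartRing f W ≃+* 𝒪_{P, w}` for `w ∈ π⁻¹ W`, when `Γ(P, π⁻¹W)` is local and zero-dimensional -/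

include hW t hP in
/-- **THE SPECIAL-FIBRE STALK OF A LOCAL ZERO-DIMENSIONAL CHART.**  `f : X → Spec A` (`A` local), `W ⊆ X` an affine open, `P = X ×_A k` the special
fibre (`hP`, `k` the residue field), `w ∈ π⁻¹W`; if `Γ(P, π⁻¹W)` is LOCAL with every prime maximal, then `Γ(X, W) ⧸ 𝔪·Γ(X, W) ≃+* 𝒪_{P, w}` by an
isomorphism with `[s] ↦ germ_w (π^♯ s)` and `[f^♯ a] ↦ germ_w (t^♯ ā)`: `exists_quotChartEquiv` followed by the germ (`bijective_germ_of_isLocalRing`).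
[cite: GortzWedhorn2020, Prop. 4.20] [cite: StacksProject, Tag 01I1] -/
theorem exists_quotChartStalkEquiv [IsLocalRing Γ(P, π ⁻¹ᵁ W)] (h0 : ∀ p : Ideal Γ(P, π ⁻¹ᵁ W), p.IsPrime → p.IsMaximal) (w : P) (hw : w ∈ π ⁻¹ᵁ W) :
    ∃ e : (ChartRing f W ⧸ (maximalIdeal A).map (algebraMap A (ChartRing f W))) ≃+* P.presheaf.stalk w,
      (∀ s : ChartRing f W, e (Ideal.Quotient.mk _ s) = P.presheaf.germ (π ⁻¹ᵁ W) w hw (π.app W (val s))) ∧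
      (∀ a : A, e (Ideal.Quotient.mk _ (algebraMap A (ChartRing f W) a)) = P.presheaf.germ (π ⁻¹ᵁ W) w hw (fibreConst π t W (residue A a))) := by
  obtain ⟨e₁, h₁, h₁'⟩ := exists_quotChartEquiv f hW π t hP
  have hb := bijective_germ_of_isLocalRing (isAffineOpen_preimage_of_isPullback f π t hP hW) h0 w hw
  refine ⟨e₁.trans (RingEquiv.ofBijective (P.presheaf.germ (π ⁻¹ᵁ W) w hw).hom hb), fun s => ?_, fun a => ?_⟩
  · rw [RingEquiv.trans_apply, h₁, RingEquiv.ofBijective_apply]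
  · rw [RingEquiv.trans_apply, h₁', RingEquiv.ofBijective_apply]

/-! ## §4 The hypotheses «local» and «zero-dimensional» from «finite over `A`», «connected preimage» -/

include t hP hW in
/-- `Γ(P, π⁻¹W)` is ARTINIAN (hence every prime is maximal) when the chart ring `Γ(X, W)` is module-finite over `A`: it is `k ⊗_A Γ(X, W)`,
finite over the residue FIELD `k`. [cite: GortzWedhorn2020, Prop. 4.20] [cite: StacksProject, Tag 00J8] -/
theorem isArtinianRing_sections_preimage [Module.Finite A (ChartRing f W)] : IsArtinianRing Γ(P, π ⁻¹ᵁ W) :=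
  haveI : IsArtinianRing (ResidueField A ⊗[A] ChartRing f W) := IsArtinianRing.of_finite (ResidueField A) _
  (fibreChartIso f π t hP hW).isArtinianRing

include t hP hW in
/-- Every prime of `Γ(P, π⁻¹W)` is maximal when `Γ(X, W)` is module-finite over `A` (Artinian rings are zero-dimensional). [cite: StacksProject, Tag 00J8] -/
theorem isMaximal_of_isPrime_sections_preimage [Module.Finite A (ChartRing f W)] (p : Ideal Γ(P, π ⁻¹ᵁ W)) (hp : p.IsPrime) : p.IsMaximal :=
  haveI := isArtinianRing_sections_preimage f hW π t hP
  (IsArtinianRing.isPrime_iff_isMaximal p).mp hp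

include t hP hW in
/-- `Γ(P, π⁻¹W)` is LOCAL when the chart ring `Γ(X, W)` is local and `π⁻¹W` is non-empty: it is the quotient `Γ(X, W) ⧸ 𝔪·Γ(X, W)` of a local ring.
[cite: StacksProject, Tag 04GG] -/
theorem isLocalRing_sections_preimage [IsLocalRing (ChartRing f W)] (w : P) (hw : w ∈ π ⁻¹ᵁ W) : IsLocalRing Γ(P, π ⁻¹ᵁ W) := by
  haveI : Nonempty ↥(π ⁻¹ᵁ W) := ⟨⟨w, hw⟩⟩
  obtain ⟨e, -, -⟩ := exists_quotChartEquiv f hW π t hP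
  exact IsLocalRing.of_surjective' (e.toRingHom.comp (Ideal.Quotient.mk _)) (e.surjective.comp Ideal.Quotient.mk_surjective)


end SpecialFibreStalk

/-! ## §5 The unit component `j : G₀ ↪ G`: its ring of functions IS the chart ring of the open `j(G₀) ⊆ G`, local and finite over `A` -/

namespace SpecialFibreStalk

open scoped MonObj

variable {A : Type u} [CommRing A] (G G₀ : Over (Spec (.of A))) (j : G₀ ⟶ G) [IsOpenImmersion j.left]

/-- **`Γ(G₀, 𝒪) ≃+* Γ(G, j(G₀))`** — the open-immersion isomorphism (Mathlib `Scheme.Hom.appIso`), read into the chart ring of the open `j(G₀) ⊆ G`; it is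
`x ↦ (j.appIso ⊤)⁻¹ x` and carries the structure map `Γ(G₀ → Spec A)^♯ (a)` to `algebraMap A Γ(G, j(G₀)) a` (`j` is a morphism OVER `Spec A`).
[cite: GortzWedhorn2020, §(3.2) and Prop. 3.4] -/
theorem exists_sectionsEquivChartRing :
    ∃ e : Γ(G₀.left, ⊤) ≃+* ChartRing G.hom (j.left ''ᵁ ⊤),
      (∀ x : Γ(G₀.left, ⊤), val (e x) = (j.left.appIso ⊤).inv x) ∧
      (∀ a : A, e (G₀.hom.appTop ((Scheme.ΓSpecIso (.of A)).inv a)) = algebraMap A (ChartRing G.hom (j.left ''ᵁ ⊤)) a) := by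
  refine ⟨(j.left.appIso ⊤).symm.commRingCatIsoToRingEquiv.trans (ChartRing.mkRingEquiv G.hom (j.left ''ᵁ ⊤)), fun x => rfl, fun a => ?_⟩
  apply val_injective
  change (j.left.appIso ⊤).inv (G₀.hom.appTop ((Scheme.ΓSpecIso (.of A)).inv a)) = val (algebraMap A (ChartRing G.hom (j.left ''ᵁ ⊤)) a)
  rw [val_algebraMap]
  have hw : G₀.hom = j.left ≫ G.hom := (Over.w j).symm
  have h1 : (G₀.hom.appTop) ((Scheme.ΓSpecIso (.of A)).inv a) = (j.left.appTop) ((G.hom.appTop) ((Scheme.ΓSpecIso (.of A)).inv a)) := by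
    rw [hw, Scheme.Hom.comp_appTop, CommRingCat.comp_apply]
  have h2 := congrArg (fun φ => φ.hom ((G.hom.appTop) ((Scheme.ΓSpecIso (.of A)).inv a))) (Scheme.Hom.app_appIso_inv j.left ⊤)
  simp only [CommRingCat.hom_comp, RingHom.comp_apply] at h2
  rw [h1]
  exact h2

/-- `Γ(G, j(G₀))` is module-finite over `A` when `G₀` is affine and finite over `Spec A` (★ `finite_structureRingHom`, transported). [cite: StacksProject, Tag 01I1] -/
theorem moduleFinite_chartRing [IsAffine G₀.left] [IsFinite G₀.hom] : Module.Finite A (ChartRing G.hom (j.left ''ᵁ ⊤)) := by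
  letI : Algebra A Γ(G₀.left, ⊤) := ((G₀.hom.appTop).hom.comp (Scheme.ΓSpecIso (.of A)).inv.hom).toAlgebra
  haveI : Module.Finite A Γ(G₀.left, ⊤) := UnitComponent.finite_structureRingHom G₀
  obtain ⟨e, -, he⟩ := exists_sectionsEquivChartRing G G₀ j
  let e' : Γ(G₀.left, ⊤) ≃ₐ[A] ChartRing G.hom (j.left ''ᵁ ⊤) := AlgEquiv.ofRingEquiv (f := e) (fun a => he a)
  exact Module.Finite.equiv e'.toLinearEquiv

/-- `Γ(G, j(G₀))` is LOCAL when `G₀` is affine, finite over a henselian local `A`, and connected (★ `UnitComponent.isLocalRing_of_connectedSpace`, transported).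
[cite: StacksProject, Tag 04GG] -/
theorem isLocalRing_chartRing [HenselianLocalRing A] [IsAffine G₀.left] [IsFinite G₀.hom] [ConnectedSpace ↥G₀.left] :
    IsLocalRing (ChartRing G.hom (j.left ''ᵁ ⊤)) := by
  letI : Algebra A Γ(G₀.left, ⊤) := ((G₀.hom.appTop).hom.comp (Scheme.ΓSpecIso (.of A)).inv.hom).toAlgebra
  haveI : Module.Finite A Γ(G₀.left, ⊤) := UnitComponent.finite_structureRingHom G₀
  haveI : ConnectedSpace (PrimeSpectrum Γ(G₀.left, ⊤)) := by
    have e := Scheme.homeoOfIso G₀.left.isoSpec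
    exact e.surjective.connectedSpace e.continuous
  haveI : IsLocalRing Γ(G₀.left, ⊤) := UnitComponent.isLocalRing_of_connectedSpace A
  obtain ⟨e, -, -⟩ := exists_sectionsEquivChartRing G G₀ j
  haveI : Nontrivial (ChartRing G.hom (j.left ''ᵁ ⊤)) := e.symm.toEquiv.nontrivial
  exact IsLocalRing.of_surjective' e.toRingHom e.surjective

/-- A point over the unit point of `G` lies over the open `j(G₀)` when `j` is a homomorphism. [cite: Tate1997FiniteFlatGroupSchemes, (3.7)] -/
theorem mem_preimage_image_top [GrpObj G] [GrpObj G₀] [IsMonHom j] [IsLocalRing A] {P : Scheme.{u}} (π : P ⟶ G.left) (w : P)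
    (hw : π.base w = (η[G]).left.base (IsLocalRing.closedPoint A)) : w ∈ π ⁻¹ᵁ (j.left ''ᵁ ⊤) := by
  change π.base w ∈ (j.left ''ᵁ ⊤ : Set G.left)
  rw [hw, ← IsMonHom.one_hom (f := j), Over.comp_left, Scheme.Hom.comp_base, TopCat.coe_comp, Function.comp_apply]
  exact ⟨_, trivial, rfl⟩


end SpecialFibreStalk

/-! ## §6 σ-INTERFACE (S1′-β split (σ)): the special-fibre stalks of the unit-component tower -/

open MonoidalCategory CartesianMonoidalCategory
open scoped MonObj CategoryTheory.Obj

/-- `appLE` of equal morphisms (a `subst` helper). [cite: GortzWedhorn2020, §(3.2)] -/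
private theorem appLE_congr_hom {X Y : Scheme.{u}} {f g : X ⟶ Y} (h : f = g) (U : Y.Opens) (V : X.Opens) (e : V ≤ f ⁻¹ᵁ U) :
    f.appLE U V e = g.appLE U V (h ▸ e) := by
  subst h
  rfl

open SpecialFibreStalk in
/-- **σ-INTERFACE (S1′-β split (σ)) «UNIT-COMPONENT SPECIAL-FIBRE STALK».**  Over an ARTINIAN LOCAL `A` (henselian, ★ `henselianLocalRing_of_isArtinianRing`)
let `j n : G₀ n ↪ G n` be a tower of homomorphic OPEN immersions of CONNECTED, AFFINE, FINITE group schemes into group schemes `G n` with homomorphic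
transitions `tr`, and `incl₀` the sub-tower maps over `tr` (the letters of ★ `BTGroup.exists_unitComponentTower`); let `P n → G n` be ANY cartesian
presentations of the special fibres `G n ×_A κ(A)` with maps `u` over `tr` and points `w n` over the unit points.  THEN the stalks `𝒪_{P n, w n}` are the
quotients `Γ(G₀ n) ⧸ 𝔪·Γ(G₀ n)` by ring isomorphisms `σ n`, NATURAL in `n` (against `incl₀^♯` and the stalk maps of `u`) and compatible with the STRUCTURE
MAPS (`Γ(G₀ n → Spec A)^♯ (a) ↦` the germ of `t_n^♯ (ā)`).  Road ([Tate1967] §2.2, «the connected component of `G ×_A k` is `G⁰ ×_A k = Spec (Γ(G⁰) ⊗ k)`,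
a local Artinian `k`-algebra»): `Γ(G₀ n) ⧸ 𝔪 ≅ k ⊗_A Γ(G₀ n) ≅ Γ(P n, π_n⁻¹ j_n(G₀ n))` (★ `Morphisms.fibreChartIso` on the affine open `j_n(G₀ n)`,
Mathlib `quotIdealMapEquivTensorQuot`), a LOCAL ring (quotient of the local ring `Γ(G₀ n)`, ★ `UnitComponent.isLocalRing_of_connectedSpace`) of dimension
zero (finite over the field `k`), whose germ map at `w n` is therefore an isomorphism (Mathlib `IsAffineOpen.isLocalization_stalk`, `IsLocalization.atUnits`).
[cite: Tate1967, §2.2 (proof of Prop. 1)] [cite: Tate1997FiniteFlatGroupSchemes, (3.7)] [cite: GortzWedhorn2020, Prop. 4.20] [cite: StacksProject, Tag 04GG] -/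
theorem exists_specialFibre_stalk_tower
    {A : Type} [CommRing A] [IsArtinianRing A] [IsLocalRing A]
    -- the A-side tower: group objects `G n`, homomorphic transitions `tr`, unit components `j n : G₀ n ⟶ G n`,
    -- sub-tower maps `incl₀` over the transitions (S1-geo's letters)
    (G : ℕ → Over (Spec (.of A))) [∀ n, GrpObj (G n)]
    (tr : ∀ ⦃n m : ℕ⦄, n ≤ m → (G n ⟶ G m))
    (G₀ : ℕ → Over (Spec (.of A))) [∀ n, GrpObj (G₀ n)] [∀ n, IsAffine (G₀ n).left]
    [∀ n, IsFinite (G₀ n).hom] [∀ n, ConnectedSpace ↥(G₀ n).left]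
    (j : ∀ n, G₀ n ⟶ G n) (hjhom : ∀ n, IsMonHom (j n)) (hjo : ∀ n, IsOpenImmersion (j n).left)
    (incl₀ : ∀ ⦃n m : ℕ⦄, n ≤ m → ((G₀ n).left ⟶ (G₀ m).left))
    (hιj : ∀ (n m : ℕ) (h : n ≤ m), incl₀ h ≫ (j m).left = (j n).left ≫ (tr h).left)
    -- the k-side tower: cartesian presentations `P n` of the special fibres `G n ×_A κ(A)`, maps `u` over `tr`,
    -- points `w n` over the unit points
    (P : ℕ → Scheme.{0}) (π : ∀ n, P n ⟶ (G n).left) (t : ∀ n, P n ⟶ Spec (.of (IsLocalRing.ResidueField A)))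
    (hP : ∀ n, IsPullback (π n) (t n) (G n).hom (Spec.map (CommRingCat.ofHom (IsLocalRing.residue A))))
    (u : ∀ ⦃n m : ℕ⦄, n ≤ m → (P n ⟶ P m))
    (huπ : ∀ (n m : ℕ) (h : n ≤ m), u h ≫ π m = π n ≫ (tr h).left)
    (w : ∀ n, ↥(P n)) (hw : ∀ n, (π n).base (w n) = (η[G n]).left.base (IsLocalRing.closedPoint A))
    (huw : ∀ (n m : ℕ) (h : n ≤ m), (u h).base (w n) = w m) :
    letI : ∀ n, Algebra A Γ((G₀ n).left, ⊤) :=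
      fun n => (((G₀ n).hom.appTop).hom.comp (Scheme.ΓSpecIso (.of A)).inv.hom).toAlgebra
    ∃ σ : ∀ n, (Γ((G₀ n).left, ⊤) ⧸ (IsLocalRing.maximalIdeal A).map (algebraMap A Γ((G₀ n).left, ⊤))) ≃+*
        ↥((P n).presheaf.stalk (w n)),
      (∀ (n m : ℕ) (h : n ≤ m) (x : Γ((G₀ m).left, ⊤)),
        σ n (Ideal.Quotient.mk _ (((incl₀ h).appTop).hom x)) =
          ((u h).stalkMap (w n)).hom (((P m).presheaf.stalkCongr (.of_eq (huw n m h))).inv.hom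
            (σ m (Ideal.Quotient.mk _ x)))) ∧
      (∀ (n : ℕ) (a : A),
        σ n (Ideal.Quotient.mk _ (((G₀ n).hom.appTop).hom ((Scheme.ΓSpecIso (.of A)).inv.hom a))) =
          ((P n).presheaf.germ ⊤ (w n) trivial).hom
            (((t n).appTop).hom ((Scheme.ΓSpecIso (.of (IsLocalRing.ResidueField A))).inv.hom
              (IsLocalRing.residue A a)))) := by
  letI instAlg : ∀ n, Algebra A Γ((G₀ n).left, ⊤) :=
    fun n => (((G₀ n).hom.appTop).hom.comp (Scheme.ΓSpecIso (.of A)).inv.hom).toAlgebra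
  haveI : HenselianLocalRing A := henselianLocalRing_of_isArtinianRing A
  haveI := hjo
  haveI := hjhom
  -- per layer: the affine open `j n (G₀ n) ⊆ G n`, its chart ring (finite over `A`, local), the point `w n` over it
  have hW : ∀ n, IsAffineOpen ((j n).left ''ᵁ (⊤ : (G₀ n).left.Opens)) := fun n => (isAffineOpen_top (G₀ n).left).image_of_isOpenImmersion (j n).left
  haveI hfin : ∀ n, Module.Finite A (ChartRing (G n).hom ((j n).left ''ᵁ ⊤)) := fun n => moduleFinite_chartRing (G n) (G₀ n) (j n)
  haveI hlocC : ∀ n, IsLocalRing (ChartRing (G n).hom ((j n).left ''ᵁ ⊤)) := fun n => isLocalRing_chartRing (G n) (G₀ n) (j n)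
  have hw' : ∀ n, w n ∈ (π n) ⁻¹ᵁ ((j n).left ''ᵁ ⊤) := fun n => mem_preimage_image_top (G n) (G₀ n) (j n) (π n) (w n) (hw n)
  haveI hloc : ∀ n, IsLocalRing Γ(P n, (π n) ⁻¹ᵁ ((j n).left ''ᵁ ⊤)) :=
    fun n => isLocalRing_sections_preimage (G n).hom (hW n) (π n) (t n) (hP n) (w n) (hw' n)
  have h0 : ∀ n (p : Ideal Γ(P n, (π n) ⁻¹ᵁ ((j n).left ''ᵁ ⊤))), p.IsPrime → p.IsMaximal :=
    fun n => isMaximal_of_isPrime_sections_preimage (G n).hom (hW n) (π n) (t n) (hP n)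
  -- the transport `Γ(G₀ n) ≃ chart ring` and the chart isomorphism `chart ring ⧸ 𝔪 ≃ stalk`, per layer
  choose eΓ hval halg' using fun n => exists_sectionsEquivChartRing (G n) (G₀ n) (j n)
  choose eQ hQ hQ' using fun n => exists_quotChartStalkEquiv (G n).hom (hW n) (π n) (t n) (hP n) (h0 n) (w n) (hw' n)
  -- the structure maps correspond, hence so do the extended maximal ideals
  have halg : ∀ n (a : A), eΓ n (algebraMap A Γ((G₀ n).left, ⊤) a) = algebraMap A (ChartRing (G n).hom ((j n).left ''ᵁ ⊤)) a :=
    fun n a => halg' n a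
  have hIJ : ∀ n, (IsLocalRing.maximalIdeal A).map (algebraMap A (ChartRing (G n).hom ((j n).left ''ᵁ ⊤))) =
      ((IsLocalRing.maximalIdeal A).map (algebraMap A Γ((G₀ n).left, ⊤))).map
        (eΓ n : Γ((G₀ n).left, ⊤) →+* ChartRing (G n).hom ((j n).left ''ᵁ ⊤)) := by
    intro n
    rw [Ideal.map_map]
    congr 1
    ext a
    exact (halg n a).symm
  refine ⟨fun n => (Ideal.quotientEquiv _ _ (eΓ n) (hIJ n)).trans (eQ n), ?_, ?_⟩
  · -- (nat) naturality against the sub-tower maps and the stalk maps of `u`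
    intro n m h x
    -- abbreviations
    have hle : (j n).left ''ᵁ (⊤ : (G₀ n).left.Opens) ≤ (tr h).left ⁻¹ᵁ ((j m).left ''ᵁ (⊤ : (G₀ m).left.Opens)) := by
      rintro _ ⟨y, -, rfl⟩
      change ((j n).left ≫ (tr h).left).base y ∈ ((j m).left ''ᵁ (⊤ : (G₀ m).left.Opens) : Set (G m).left)
      rw [← hιj n m h, Scheme.Hom.comp_base, TopCat.coe_comp, Function.comp_apply]
      exact ⟨_, trivial, rfl⟩
    -- CLAIM A: the section `incl₀^♯ x` read in the chart ring of `j n (G₀ n)` is the restriction of `x` (read in the chart ring of `j m (G₀ m)`) along `tr`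
    have hA : ((j n).left.appIso ⊤).inv (((incl₀ h).appTop).hom x) =
        ((tr h).left.appLE ((j m).left ''ᵁ ⊤) ((j n).left ''ᵁ ⊤) hle) (((j m).left.appIso ⊤).inv x) := by
      -- apply the isomorphism `(j n).appIso ⊤` to both sides
      have hinj : Function.Injective ((j n).left.appIso ⊤).hom := ((j n).left.appIso ⊤).commRingCatIsoToRingEquiv.injective
      apply hinj
      rw [← CommRingCat.comp_apply, Iso.inv_hom_id, CommRingCat.id_apply, Scheme.Hom.appIso_hom', ← CommRingCat.comp_apply,
        Scheme.Hom.appLE_comp_appLE, appLE_congr_hom (hιj n m h).symm, ← Scheme.Hom.appLE_comp_appLE (incl₀ h) (j m).left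
          ((j m).left ''ᵁ ⊤) ⊤ ⊤ ((j m).left.preimage_image_eq ⊤).ge le_top, CommRingCat.comp_apply, ← CommRingCat.comp_apply _
          ((j m).left.appLE _ _ _), Scheme.Hom.appIso_inv_appLE]
      change ((incl₀ h).app ⊤) x = ((incl₀ h).appLE ⊤ ⊤ _) ((G₀ m).left.presheaf.map (homOfLE le_rfl).op x)
      rw [Scheme.Hom.app_eq_appLE]
      congr 1
      exact (congrArg (fun k => ((G₀ m).left.presheaf.map k).hom x) (Subsingleton.elim _ (𝟙 _))).trans
        (by rw [(G₀ m).left.presheaf.map_id]; rfl) |>.symm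
    -- both sides are the germ at `w n` of `(π n ≫ tr)^♯ y` on `(π n ≫ tr)⁻¹ (j m (G₀ m))`, `y := (j m appIso ⊤)⁻¹ x`
    have hwV : w n ∈ (π n ≫ (tr h).left) ⁻¹ᵁ ((j m).left ''ᵁ (⊤ : (G₀ m).left.Opens)) := by
      change (π n ≫ (tr h).left).base (w n) ∈ ((j m).left ''ᵁ (⊤ : (G₀ m).left.Opens) : Set (G m).left)
      rw [← huπ n m h, Scheme.Hom.comp_base, TopCat.coe_comp, Function.comp_apply, huw n m h]
      exact hw' m
    change eQ n (Ideal.quotientEquiv _ _ (eΓ n) (hIJ n) (Ideal.Quotient.mk _ _)) =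
      ((u h).stalkMap (w n)).hom (((P m).presheaf.stalkCongr (.of_eq (huw n m h))).inv.hom
        (eQ m (Ideal.quotientEquiv _ _ (eΓ m) (hIJ m) (Ideal.Quotient.mk _ x))))
    rw [Ideal.quotientEquiv_mk, Ideal.quotientEquiv_mk, hQ, hQ, hval, hval, hA, TopCat.Presheaf.stalkCongr_inv, TopCat.Presheaf.germ_stalkSpecializes_apply,
      Scheme.Hom.germ_stalkMap_apply, ← CommRingCat.comp_apply ((π m).app _), ← Scheme.Hom.comp_app, Scheme.Hom.congr_app (huπ n m h),
      CommRingCat.comp_apply, TopCat.Presheaf.germ_res_apply', ← CommRingCat.comp_apply _ ((π n).app _), Scheme.Hom.app_eq_appLE (π n),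
      Scheme.Hom.appLE_comp_appLE]
    change ((P n).presheaf.germ _ (w n) (hw' n)) ((((π n ≫ (tr h).left).app _) ≫ (P n).presheaf.map (homOfLE _).op) _) = _
    rw [CommRingCat.comp_apply]
    exact TopCat.Presheaf.germ_res_apply (P n).presheaf (homOfLE _) (w n) (hw' n) _
  · -- (const) the structure maps
    intro n a
    change eQ n (Ideal.quotientEquiv _ _ (eΓ n) (hIJ n) (Ideal.Quotient.mk _ (algebraMap A Γ((G₀ n).left, ⊤) a))) = _
    rw [Ideal.quotientEquiv_mk]
    change eQ n (Ideal.Quotient.mk _ (eΓ n (algebraMap A Γ((G₀ n).left, ⊤) a))) = _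
    rw [halg n a, hQ', fibreConst_apply]
    change ((P n).presheaf.germ _ (w n) (hw' n)) (((t n).app ⊤ ≫ (P n).presheaf.map (homOfLE le_top).op) _) = _
    rw [CommRingCat.comp_apply]
    exact TopCat.Presheaf.germ_res_apply (P n).presheaf (homOfLE le_top) (w n) (hw' n) _


end Literature.AlgebraicGeometry.GroupSchemes

end
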